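import Summits.BirchSwinnertonDyer.BirchSwinnertonDyer.Theorems.SignedLowerHalvesSmallImageLowerHalfBothSignsMuRiderParityPackets
import Summits.BirchSwinnertonDyer.BirchSwinnertonDyer.Theorems.SignedLowerHalvesSmallImageLowerHalfBothSignsMuRiderNode
import HarnessLib

/-!
# Route `SignedLowerHalves` (K3), crux L `SmallImageLowerHalfBothSigns` (item stmt-BirchSwinnertonDyer-23599), line
# `birth_acns` v14, stub `stub_muBothSigns_ns`: THE PARITY-PACKET ROAD, part 2 — curve form, both signs at a pair,
# the node `SignedMuVanishing` and the registered stub text from the parity-split B⁰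
# (cell `bsd-ssimc`, width seat `bsd-line-slh-p3-w2` gen 4; helper file `--supports 23599`; THEOREMS ONLY)

Part 1 (`…MuRiderParityPackets.lean`, same namespace) proves the LEVEL FORM
`exists_norm_teichOrbitSum_eq_one_of_parityPackets`: for a rational newform `f` on `Γ₀(N)`, `p` odd, `p ∤ N`,
`a_p(f) = 0`, the PARITY-PACKET HYPOTHESIS at `(N, p, π)` — a set `S ⊆ Γ₀(N)` of Teichmüller packet products at
levels `n ≥ 1`, `n ≡ π (mod 2)`, finite-order / trace-`±2` elements and `p`-th powers with `γ·γ^ι ∈ ⟨S⟩·[Γ₀(N),Γ₀(N)]`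
for every good `γ` (vocabulary of `…AnalyticMuZeroX9TeichSpanDefs.lean`: `IsTeichPacket`, `iotaGamma0`; B⁰ =
`TeichSpanGen N p` is the parity-free case) — yields a UNIT Teichmüller-orbit sum at a level of parity `π`.  Here:

* §2 `exists_isSignedPAdicLFunction_hasUnitContent_of_parityPackets` — CURVE FORM: `W/ℚ` globally minimal, `p` odd
  good with `a_p = 0`, `f` its newform of level `N`; parity-packets at `(N, p, π)` ⟹ `∃ L, IsSignedPAdicLFunction f p ε L
  ∧ HasUnitContent L` with `ε = 1` for `π` odd, `ε = −1` for `π` even (`E[p]` irreducible by Serre Prop. 12, winding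
  non-constancy = THEOREM B input-free, an orbit sum at level `n+1` is a group-ring coefficient of `θ_n`, and
  `SmallImageOrbitSumMu`); the `∀ L` form; `forall_sign_exists_signed_hasUnitContent_of_parityPackets` — BOTH
  parities ⟹ the conclusion of `stub_muBothSigns_ns` AT THAT PAIR.
* §3 CLASS FORM: `signedMuVanishing_of_parityPackets` (the node at a pair), `signedMuVanishing_of_parityPacketsAll`
  (PARITY-PACKETS at every odd `p`, level prime to `p`, both parities ⟹ the node at EVERY odd supersingular pair with
  `a_p = 0`, no image / CM hypothesis) and `muBothSigns_of_parityPacketsAll` — the registered stub text VERBATIM (its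
  class binders idle).

HONEST FRAMING: the parity-packet hypothesis is displayed, never asserted (the parity-split form of the OPEN
Conjecture B⁰; kit-testable per `(N, p, π)` like the B⁰ census); the stub (`stub-misstated`, gens 0/2/3), child L,
crux 4 and BSD are NOT proved by any of this.

References: [Manin1972] Prop. 1.4; [MazurTateTeitelbaum1986Invent] §I.10 (10.1); [Pollack2003] Thm. 5.6, Prop. 6.18,
Conj. 6.3; [PollackWeston2011] Thm. 4.1 (1), Rem. 4.2; [PerrinRiou2003] §6.1 Conj. 6.1.1; [Serre1972] §1.11 Prop. 12.
-/

-- D-0017: single-problem summit, the namespace repeats the problem name by design.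
set_option linter.dupNamespace false
set_option autoImplicit false

noncomputable section

open scoped Classical MatrixGroups ModularForm

open Polynomial CongruenceSubgroup Matrix Matrix.SpecialLinearGroup
  Literature.NumberTheory.EllipticCurves Literature.NumberTheory.EllipticCurves.ModularForms
  Literature.NumberTheory.EllipticCurves.Kobayashi2003 Literature.NumberTheory.EllipticCurves.GreenbergVatsal2000
  Literature.NumberTheory.EllipticCurves.Rank1Residual

namespace Summit.BirchSwinnertonDyer.BirchSwinnertonDyer.Theorems.SmallImageLowerHalfBothSignsMuRiderParityPackets

open Summit.BirchSwinnertonDyer.BirchSwinnertonDyer.Cruxes.AnalyticMuZeroX9.TeichSpan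
open Summit.BirchSwinnertonDyer.BirchSwinnertonDyer.Theorems.SmallImageTeichOrbitMu
  (teichOrbitSum_eq_coeff_comp_mazurTateElement)
open Summit.BirchSwinnertonDyer.BirchSwinnertonDyer.Theorems.SmallImageOrbitSumMu
  (exists_isSignedPAdicLFunction_hasUnitContent_of_norm_coeff_eq_one)

/-! ## §2 Curve form: the parity-packet hypothesis at `(N_f, p, π)` gives `μ(L_p^ε(E)) = 0` for the sign of `π` -/

section Curve

variable {W : WeierstrassCurve ℚ} [W.IsElliptic] [W.IsGloballyMinimal] {p : ℕ} [Fact p.Prime]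
  {N : ℕ} [NeZero N] {f : CuspForm (Gamma0 N) 2}

/-- **One sign from one parity.**  `W/ℚ` globally minimal, `p` odd of good reduction with `a_p = 0`, `f` its newform
(level `N`); `ε = 1` if `π` is odd, `ε = −1` if `π` is even.  IF the `ι`-norms of all good `γ ∈ Γ₀(N)` lie in
`⟨S⟩·[Γ₀(N),Γ₀(N)]` for a set `S` of parity-`π` Teichmüller packet products, finite-order / trace-`±2` elements and
`p`-th powers, THEN `∃ L, IsSignedPAdicLFunction f p ε L ∧ HasUnitContent L` (`μ(L_p^ε(E)) = 0`).  Proof: `E[p]` is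
irreducible (Serre Prop. 12, supersingular), so `[·]⁺_f` is `p`-integral at the `p`-power cusps and non-constant there
(THEOREM B, input-free); §1 gives a unit orbit sum `S_f(p, n+1, b)` with `n + 1 ≡ π`; `b = η̄₀γˢ` makes it the
coefficient of `(1+T)ˢ` in `θ_n(f)`, and a unit coefficient at a level of parity `n` gives the signed function of
that parity with unit content (`SmallImageOrbitSumMu`).
[cite: MazurTateTeitelbaum1986Invent, §I.10 (10.1)] [cite: PollackWeston2011, Thm. 4.1 (1)] [cite: Serre1972, §1.11 Prop. 12] -/
theorem exists_isSignedPAdicLFunction_hasUnitContent_of_parityPackets (hp2 : p ≠ 2) (hf : IsNewformOf W f)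
    (hgood : W.HasGoodReductionAtPrime p) (hap : W.frobeniusTrace p = 0) {π : ℕ} {ε : ℤˣ}
    (hε : (π % 2 = 1 ∧ ε = 1) ∨ (π % 2 = 0 ∧ ε = -1)) {S : Set (Gamma0 N)}
    (hS : ∀ γ ∈ S, (∃ (n : ℕ) (l : List (Gamma0 N)), 1 ≤ n ∧ n % 2 = π % 2 ∧ IsTeichPacket N p n l ∧
        γ = l.prod) ∨ (IsOfFinOrder γ ∨ trEntry γ = 2 ∨ trEntry γ = -2) ∨ ∃ h : Gamma0 N, γ = h ^ p)
    (hB : ∀ γ : Gamma0 N, IsGoodAt p γ → γ * iotaGamma0 γ ∈ Subgroup.closure S ⊔ commutator (Gamma0 N)) :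
    ∃ L : IwasawaAlgebra p, IsSignedPAdicLFunction f p ε L ∧ HasUnitContent L := by
  have hp : p.Prime := Fact.out
  have hpN : ¬ p ∣ N := not_dvd_level_of_isNewformOf hf hgood
  have hap' : cuspCoeff f p = ((0 : ℤ) : ℂ) := by
    rw [cuspCoeff_eq_frobeniusTrace_of_isNewformOf_holds hf hgood, hap]
  have hirr : W.HasIrreducibleModPGaloisRep p :=
    hasIrreducibleModPGaloisRep_of_dvd_frobeniusTrace W p hp2
      (W.not_dvd_minimalDiscriminantInt_of_hasGoodReductionAtPrime' p hgood) (by rw [hap]; exact dvd_zero _)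
  obtain ⟨n₀, hpn₀, h0⟩ :=
    exists_intCast_mul_modularSymbol_zero_mem not_irreducible_of_frobeniusTrace_congr_holds hf hirr
  have hcyc : CycWindingNonConstantAt W p :=
    Summit.BirchSwinnertonDyer.BirchSwinnertonDyer.Rank1Residual.EvenBranch.cycWindingNonConstantAt_of_odd
      W p hp2 hgood hirr
  obtain ⟨m, hm, hpar, b, hb1⟩ := exists_norm_teichOrbitSum_eq_one_of_parityPackets hf.1 hf.coeffField_eq_bot
    hp2 hpN hap' hpn₀ h0 π hS hB (hcyc f hf)
  obtain ⟨n, rfl⟩ : ∃ n, m = n + 1 := ⟨m - 1, by omega⟩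
  -- `b = η̄₀ γˢ`: the orbit sum is the coefficient of `(1+T)ˢ` in `θ_n`
  obtain ⟨ξ₀, s, hb⟩ := exists_coe_eq_toZModPow_mul_pow hp2 n b
  have hs : s.val < p ^ n := by
    haveI : NeZero (p ^ n) := ⟨pow_ne_zero _ hp.ne_zero⟩
    exact ZMod.val_lt s
  rw [teichOrbitSum_eq_coeff_comp_mazurTateElement f hp2 n ξ₀ hs (b : ZMod (p ^ (n + 1))) hb] at hb1
  have hε' : (Even n ∧ ε = 1) ∨ (Odd n ∧ ε = -1) := by
    rcases hε with ⟨hπ, rfl⟩ | ⟨hπ, rfl⟩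
    · exact Or.inl ⟨Nat.even_iff.mpr (by omega), rfl⟩
    · exact Or.inr ⟨Nat.odd_iff.mpr (by omega), rfl⟩
  exact exists_isSignedPAdicLFunction_hasUnitContent_of_norm_coeff_eq_one hp2 hf hgood hap hε' hb1

/-- **The `∀ L` form**: under the same hypotheses EVERY signed function of that sign has unit content.
[cite: Kobayashi2003, Thm. 3.2] [cite: PollackWeston2011, Thm. 4.1 (1)] -/
theorem hasUnitContent_of_isSignedPAdicLFunction_of_parityPackets (hp2 : p ≠ 2) (hf : IsNewformOf W f)
    (hgood : W.HasGoodReductionAtPrime p) (hap : W.frobeniusTrace p = 0) {π : ℕ} {ε : ℤˣ}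
    (hε : (π % 2 = 1 ∧ ε = 1) ∨ (π % 2 = 0 ∧ ε = -1)) {S : Set (Gamma0 N)}
    (hS : ∀ γ ∈ S, (∃ (n : ℕ) (l : List (Gamma0 N)), 1 ≤ n ∧ n % 2 = π % 2 ∧ IsTeichPacket N p n l ∧
        γ = l.prod) ∨ (IsOfFinOrder γ ∨ trEntry γ = 2 ∨ trEntry γ = -2) ∨ ∃ h : Gamma0 N, γ = h ^ p)
    (hB : ∀ γ : Gamma0 N, IsGoodAt p γ → γ * iotaGamma0 γ ∈ Subgroup.closure S ⊔ commutator (Gamma0 N))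
    {L : IwasawaAlgebra p} (hL : IsSignedPAdicLFunction f p ε L) : HasUnitContent L := by
  obtain ⟨L', hL', hμ'⟩ :=
    exists_isSignedPAdicLFunction_hasUnitContent_of_parityPackets hp2 hf hgood hap hε hS hB
  rwa [hL.unique hL']

/-- **BOTH signs at one pair from BOTH parities** — the conclusion of `stub_muBothSigns_ns` AT THAT PAIR: the
parity-packet hypothesis at `(N, p, 0)` (even levels) and at `(N, p, 1)` (odd levels) for the level `N` of the
newform of `W` give `∀ ε, ∃ L₀, IsSignedPAdicLFunction f p ε L₀ ∧ HasUnitContent L₀`.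
[cite: Pollack2003, Conj. 6.3 (p. 548), Prop. 6.18] [cite: PollackWeston2011, Thm. 4.1 (1)] -/
theorem forall_sign_exists_signed_hasUnitContent_of_parityPackets (hp2 : p ≠ 2) (hf : IsNewformOf W f)
    (hgood : W.HasGoodReductionAtPrime p) (hap : W.frobeniusTrace p = 0) {S₀ S₁ : Set (Gamma0 N)}
    (hS₀ : ∀ γ ∈ S₀, (∃ (n : ℕ) (l : List (Gamma0 N)), 1 ≤ n ∧ n % 2 = 0 ∧ IsTeichPacket N p n l ∧
        γ = l.prod) ∨ (IsOfFinOrder γ ∨ trEntry γ = 2 ∨ trEntry γ = -2) ∨ ∃ h : Gamma0 N, γ = h ^ p)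
    (hB₀ : ∀ γ : Gamma0 N, IsGoodAt p γ → γ * iotaGamma0 γ ∈ Subgroup.closure S₀ ⊔ commutator (Gamma0 N))
    (hS₁ : ∀ γ ∈ S₁, (∃ (n : ℕ) (l : List (Gamma0 N)), 1 ≤ n ∧ n % 2 = 1 ∧ IsTeichPacket N p n l ∧
        γ = l.prod) ∨ (IsOfFinOrder γ ∨ trEntry γ = 2 ∨ trEntry γ = -2) ∨ ∃ h : Gamma0 N, γ = h ^ p)
    (hB₁ : ∀ γ : Gamma0 N, IsGoodAt p γ → γ * iotaGamma0 γ ∈ Subgroup.closure S₁ ⊔ commutator (Gamma0 N)) :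
    ∀ ε : ℤˣ, ∃ L₀ : IwasawaAlgebra p, IsSignedPAdicLFunction f p ε L₀ ∧ HasUnitContent L₀ := by
  intro ε
  rcases Int.units_eq_one_or ε with rfl | rfl
  · exact exists_isSignedPAdicLFunction_hasUnitContent_of_parityPackets (π := 1) hp2 hf hgood hap
      (Or.inl ⟨rfl, rfl⟩) hS₁ hB₁
  · exact exists_isSignedPAdicLFunction_hasUnitContent_of_parityPackets (π := 0) hp2 hf hgood hap
      (Or.inr ⟨rfl, rfl⟩) hS₀ hB₀

end Curve

/-! ## §3 Class form: the registered stub text and the node `SignedMuVanishing` from the parity-packet hypothesis -/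

section ClassForm

open Summit.BirchSwinnertonDyer.Rank1Residual.Supersingular (SignedMuVanishing)
open Summit.BirchSwinnertonDyer.BirchSwinnertonDyer.Theorems.SmallImageLowerHalfBothSignsMuRiderNode
  (signedMuVanishing_of_forall_sign_exists_signed_hasUnitContent)

/-- **The node at one pair from both parities.**  `W/ℚ` globally minimal, `p` odd good with `a_p = 0`, `f` the
conductor-level newform: the parity-packet hypotheses at `(N_E, p, 0)` and `(N_E, p, 1)` give the tree's conjecture
node `Supersingular.SignedMuVanishing W p` (every colour of the Sprung pair non-zero with `μ = 0`) — via §2 and the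
gen-2 dictionary `signedMuVanishing_of_forall_sign_exists_signed_hasUnitContent`.
[cite: PerrinRiou2003, §6.1 Conjecture 6.1.1] [cite: PollackWeston2011, Thm. 4.1 (1), Rem. 4.2] -/
theorem signedMuVanishing_of_parityPackets {W : WeierstrassCurve ℚ} [W.IsElliptic] [W.IsGloballyMinimal]
    {p : ℕ} [Fact p.Prime] (hp2 : p ≠ 2) (hgood : W.HasGoodReductionAtPrime p) (hap : W.frobeniusTrace p = 0)
    [NeZero (W.conductorNorm ℤ)] {f : CuspForm (Gamma0 (W.conductorNorm ℤ)) 2} (hf : IsNewformOf W f)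
    {S₀ S₁ : Set (Gamma0 (W.conductorNorm ℤ))}
    (hS₀ : ∀ γ ∈ S₀, (∃ (n : ℕ) (l : List (Gamma0 (W.conductorNorm ℤ))), 1 ≤ n ∧ n % 2 = 0 ∧
        IsTeichPacket (W.conductorNorm ℤ) p n l ∧ γ = l.prod) ∨
        (IsOfFinOrder γ ∨ trEntry γ = 2 ∨ trEntry γ = -2) ∨ ∃ h : Gamma0 (W.conductorNorm ℤ), γ = h ^ p)
    (hB₀ : ∀ γ : Gamma0 (W.conductorNorm ℤ), IsGoodAt p γ →
      γ * iotaGamma0 γ ∈ Subgroup.closure S₀ ⊔ commutator (Gamma0 (W.conductorNorm ℤ)))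
    (hS₁ : ∀ γ ∈ S₁, (∃ (n : ℕ) (l : List (Gamma0 (W.conductorNorm ℤ))), 1 ≤ n ∧ n % 2 = 1 ∧
        IsTeichPacket (W.conductorNorm ℤ) p n l ∧ γ = l.prod) ∨
        (IsOfFinOrder γ ∨ trEntry γ = 2 ∨ trEntry γ = -2) ∨ ∃ h : Gamma0 (W.conductorNorm ℤ), γ = h ^ p)
    (hB₁ : ∀ γ : Gamma0 (W.conductorNorm ℤ), IsGoodAt p γ →
      γ * iotaGamma0 γ ∈ Subgroup.closure S₁ ⊔ commutator (Gamma0 (W.conductorNorm ℤ))) :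
    SignedMuVanishing W p :=
  signedMuVanishing_of_forall_sign_exists_signed_hasUnitContent hap hf
    (forall_sign_exists_signed_hasUnitContent_of_parityPackets hp2 hf hgood hap hS₀ hB₀ hS₁ hB₁)

/-- **PARITY-PACKETS-ALL ⟹ the node at every odd supersingular pair.**  IF at every odd prime `p`, every level `N`
prime to `p` and every parity `π` some set `S ⊆ Γ₀(N)` of parity-`π` packet products / Eisenstein-trivial elements /
`p`-th powers generates the `ι`-norms of all good `γ` modulo commutators (displayed hypothesis `hPP`; the parity-split
form of Conjecture B⁰, OPEN, never asserted), THEN `SignedMuVanishing W p` for every `W/ℚ` with good reduction at the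
odd prime `p` and `a_p = 0` — no image, CM or class hypothesis.
[cite: PerrinRiou2003, §6.1 Conjecture 6.1.1] [cite: Pollack2003, Conj. 6.3 (p. 548)] -/
theorem signedMuVanishing_of_parityPacketsAll
    (hPP : ∀ (N p : ℕ) [Fact p.Prime], p ≠ 2 → ¬ p ∣ N → ∀ π : ℕ, ∃ S : Set (Gamma0 N),
      (∀ γ ∈ S, (∃ (n : ℕ) (l : List (Gamma0 N)), 1 ≤ n ∧ n % 2 = π % 2 ∧ IsTeichPacket N p n l ∧
        γ = l.prod) ∨ (IsOfFinOrder γ ∨ trEntry γ = 2 ∨ trEntry γ = -2) ∨ ∃ h : Gamma0 N, γ = h ^ p) ∧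
      ∀ γ : Gamma0 N, IsGoodAt p γ → γ * iotaGamma0 γ ∈ Subgroup.closure S ⊔ commutator (Gamma0 N))
    {W : WeierstrassCurve ℚ} [W.IsElliptic] [W.IsGloballyMinimal] {p : ℕ} [Fact p.Prime] (hp2 : p ≠ 2)
    (hgood : W.HasGoodReductionAtPrime p) (hap : W.frobeniusTrace p = 0) : SignedMuVanishing W p := by
  intro _ f hf Lsharp Lflat hSP c
  have hpN : ¬ p ∣ W.conductorNorm ℤ := not_dvd_level_of_isNewformOf hf hgood
  obtain ⟨S₀, hS₀, hB₀⟩ := hPP (W.conductorNorm ℤ) p hp2 hpN 0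
  obtain ⟨S₁, hS₁, hB₁⟩ := hPP (W.conductorNorm ℤ) p hp2 hpN 1
  exact signedMuVanishing_of_parityPackets hp2 hgood hap hf hS₀ hB₀ hS₁ hB₁ f hf Lsharp Lflat hSP c

/-- **PARITY-PACKETS-ALL ⟹ the registered stub `stub_muBothSigns_ns` of line `birth_acns` v14, VERBATIM** (its class
binders `ClassX7`, `¬CM`, `¬Surj` are idle; only good reduction and `a_p = 0` are used).  The by-name reduction
«both-signs `μ`-rider at every small-image supersingular X7 pair ⟸ the parity-split B⁰» — conditional on the OPEN
displayed hypothesis `hPP`; the stub is NOT discharged.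
[cite: Pollack2003, Conj. 6.3 (p. 548), Prop. 6.18] [cite: PollackWeston2011, Thm. 4.1 (1)] -/
theorem muBothSigns_of_parityPacketsAll
    (hPP : ∀ (N p : ℕ) [Fact p.Prime], p ≠ 2 → ¬ p ∣ N → ∀ π : ℕ, ∃ S : Set (Gamma0 N),
      (∀ γ ∈ S, (∃ (n : ℕ) (l : List (Gamma0 N)), 1 ≤ n ∧ n % 2 = π % 2 ∧ IsTeichPacket N p n l ∧
        γ = l.prod) ∨ (IsOfFinOrder γ ∨ trEntry γ = 2 ∨ trEntry γ = -2) ∨ ∃ h : Gamma0 N, γ = h ^ p) ∧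
      ∀ γ : Gamma0 N, IsGoodAt p γ → γ * iotaGamma0 γ ∈ Subgroup.closure S ⊔ commutator (Gamma0 N)) :
    ∀ (W : WeierstrassCurve ℚ) [W.IsElliptic] [W.IsGloballyMinimal] (p : ℕ) [Fact p.Prime],
      p ≠ 2 → ClassX7 W p → ¬ W.HasCM → W.frobeniusTrace p = 0 → ¬ Surj W p →
      ∀ [NeZero (W.conductorNorm ℤ)] (f : CuspForm (Gamma0 (W.conductorNorm ℤ)) 2),
      IsNewformOf W f → ∀ ε : ℤˣ, ∃ L₀ : IwasawaAlgebra p,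
        IsSignedPAdicLFunction f p ε L₀ ∧ HasUnitContent L₀ := by
  intro W _ _ p _ hp2 hX _ hap _ _ f hf
  have hgood : W.HasGoodReductionAtPrime p := hX.1.1
  have hpN : ¬ p ∣ W.conductorNorm ℤ := not_dvd_level_of_isNewformOf hf hgood
  obtain ⟨S₀, hS₀, hB₀⟩ := hPP (W.conductorNorm ℤ) p hp2 hpN 0
  obtain ⟨S₁, hS₁, hB₁⟩ := hPP (W.conductorNorm ℤ) p hp2 hpN 1
  exact forall_sign_exists_signed_hasUnitContent_of_parityPackets hp2 hf hgood hap hS₀ hB₀ hS₁ hB₁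

end ClassForm

end Summit.BirchSwinnertonDyer.BirchSwinnertonDyer.Theorems.SmallImageLowerHalfBothSignsMuRiderParityPackets

end
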